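import Summits.NavierStokesRegularity.NavierStokesRegularity.Theorems.HubbleDynamoNoSelfExcitedDynamoEquivalence
import Literature.Analysis.FluidPDE.NSBoundedMildOseenDuhamel
import HarnessLib

/-!
# Crux `NoSelfExcitedDynamo` (stmt-NavierStokesRegularity-1934), line `registered`:
# stubs `stub_singleTimeSwitchOff` and `stub_pastSmallnessLiouville`

Theorems file (`--supports stmt-NavierStokesRegularity-1934`; theorems only, sorry-free). Let `(U, P)`
be an ETERNAL classical solution of Leray's backward system
`∂ₛU + ½U + ½(y·∇)U + (U·∇)U + ∇P = ΔU`, `div U = 0` on `ℝ × ℝ³` (`IsBackwardLeraySolutionOn univ 1 U P`)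
in the uniform profile class `(1 + ‖y‖)^{k+1} ‖DᵏU(s, ·)(y)‖ ≤ K_k`.

* `stub_singleTimeSwitchOff` (KNSS's `L^∞` local theory made scale invariant): there is an absolute
  `ε₀ > 0` such that `‖U(s₀, ·)‖_∞ ≤ ε ≤ ε₀` at ONE similarity time forces
  `‖U(s, y)‖ ≤ 2ε e^{−(s − s₀)/2}` for all `s ≥ s₀`.
* `stub_pastSmallnessLiouville` (corollary): if the amplitude is `δ`-small at arbitrarily early
  similarity times for every `δ > 0`, then `U ≡ 0`.

## Proof of the switch-off

Physical variables: `u = ofLerayOrbit U` is a classical Navier–Stokes solution on `(−∞, 0) × ℝ³`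
(`isClassicalNSSolutionOn_Iio_ofLerayOrbit_iff`) with the Type-I bound `‖u(t, x)‖ ≤ K₀/(‖x‖ + √(−t))`
(`hasTypeIDecay_iff_lerayOrbit`), hence `‖u(t)‖_∞ ≤ K₀/√(−t)` and `r‖u‖ ≤ K₀`, so KNSS 2009, Thm 6.1
(mildness clause, `KNSS2009_mild_of_rMulNorm_bounded_holds`) gives the Oseen identity
`u(t) = e^{(t−s)Δ}u(s) − B¹_s(u,u)(t)` between all negative times `s < t`. With `t₀ = −e^{−s₀}`,
`‖u(t₀)‖_∞ ≤ a := ε/√(−t₀)`. For any `b > a` with `16 C b √(−t₀) ≤ 1` (`C` the constant of the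
bilinear bound `‖B¹_s(u,u)(t)‖_∞ ≤ C M² · 2√(t − s)`, `exists_norm_oseenDuhamel_bounded_le`) the bound
`‖u‖ ≤ 2b` propagates from `t₀` up to `t = 0` by induction on time blocks of a fixed length `η`
(`switchOff_trap`): on a segment `[t₀, t₁]` where `‖u‖ ≤ 2b` the Oseen identity from `t₀` improves the
bound to `a + 8 C b² √(−t₀) ≤ 3b/2`, and the Oseen identity from `t₁` with the crude a-priori bound
`K₀/√(−T)` on `(t₁, T]` extends `‖u‖ ≤ 3b/2 + 2 C (K₀²/(−T)) √η ≤ 2b` to `[t₁, t₁ + η]`. Letting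
`b ↓ a` (`switchOff_physical`) gives `‖u(t)‖_∞ ≤ 2a` on `[t₀, 0)`, i.e.
`‖U(s, y)‖ = e^{−s/2}‖u(−e^{−s}, ·)‖ ≤ 2ε e^{−(s−s₀)/2}`.
-/

noncomputable section

-- the mandated stub namespace repeats `NavierStokesRegularity` (tree precedent for this crux's stubs)
set_option linter.dupNamespace false

namespace Summit.NavierStokesRegularity.NavierStokesRegularity.Theorems.NoSelfExcitedDynamo.Registered

open Set MeasureTheory Filter Topology
open scoped ContDiff
open Literature.Analysis.FluidPDE

/-! ### The trapping argument in physical variables -/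

/-- **Trapping with room.** Let `u` be Oseen-mild between all pairs of negative times, with the
bilinear bound `‖B¹_s(u,u)(t)‖ ≤ 2 C M² √(t − s)` under `‖u‖ ≤ M` on `(s, t)`, and the crude bound
`‖u(t)‖_∞ ≤ K₀/√(−t)`. If `‖u(t₀)‖_∞ ≤ a < b` and `16 C b √(−t₀) ≤ 1`, then `‖u(t)‖_∞ ≤ 2b` for all
`t ∈ [t₀, 0)`: induction on blocks `[t₀, t₀ + nη] ∩ [t₀, t]` — on a segment where `‖u‖ ≤ 2b` the
Oseen identity from `t₀` gives `‖u‖ ≤ a + 8 C b² √(−t₀) ≤ 3b/2`, and the Oseen identity from the end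
of the segment with the crude bound `M' = K₀/√(−t)` gives `‖u‖ ≤ 3b/2 + 2 C M'² √η ≤ 2b` on the next
block of length `η = (b/(4 C M'² + 4))²`. -/
theorem switchOff_trap {u : ℝ → EuclideanSpace ℝ (Fin 3) → EuclideanSpace ℝ (Fin 3)}
    {C K₀ t₀ a b : ℝ} (hC : 0 < C)
    (hB : ∀ s t M : ℝ, s < t → 0 ≤ M → (∀ τ ∈ Ioo s t, ∀ y, ‖u τ y‖ ≤ M) →
      ∀ x, ‖oseenDuhamel 1 s u u t x‖ ≤ 2 * C * M ^ 2 * Real.sqrt (t - s))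
    (hmild : ∀ s t : ℝ, s < t → t < 0 → ∀ x,
      u t x = Literature.Analysis.UnboundedOperators.heatExtension (u s) (t - s) x -
        oseenDuhamel 1 s u u t x)
    (hK₀ : 0 ≤ K₀) (hcrude : ∀ t < 0, ∀ x, ‖u t x‖ ≤ K₀ / Real.sqrt (-t))
    (ha : ∀ x, ‖u t₀ x‖ ≤ a) (hab : a < b) (hb : 16 * C * b * Real.sqrt (-t₀) ≤ 1) :
    ∀ t ∈ Ico t₀ 0, ∀ x, ‖u t x‖ ≤ 2 * b := by
  have ha0 : 0 ≤ a := (norm_nonneg _).trans (ha 0)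
  have hb0 : 0 < b := ha0.trans_lt hab
  intro t ht x
  rcases eq_or_lt_of_le ht.1 with heq | ht₀t
  · rw [← heq]
    linarith [ha x]
  -- the crude bound on times `≤ t`
  have hsqt : 0 < Real.sqrt (-t) := Real.sqrt_pos.2 (neg_pos.2 ht.2)
  set M' : ℝ := K₀ / Real.sqrt (-t) with hM'
  have hM'0 : 0 ≤ M' := div_nonneg hK₀ (Real.sqrt_nonneg _)
  have hcrude' : ∀ τ ≤ t, ∀ x, ‖u τ x‖ ≤ M' := fun τ hτ x =>
    (hcrude τ (hτ.trans_lt ht.2) x).trans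
      (div_le_div_of_nonneg_left hK₀ hsqt (Real.sqrt_le_sqrt (by linarith)))
  -- the block length
  set ρ : ℝ := b / (4 * C * M' ^ 2 + 4) with hρ
  have hD : 0 < 4 * C * M' ^ 2 + 4 := by positivity
  have hρ0 : 0 < ρ := by positivity
  have hρb : 2 * C * M' ^ 2 * ρ ≤ b / 2 := by
    rw [hρ, mul_div_assoc', div_le_div_iff₀ hD two_pos]
    nlinarith [hb0, mul_nonneg hC.le (sq_nonneg M')]
  set η : ℝ := ρ ^ 2 with hη
  have hη0 : 0 < η := by positivity
  have hsqη : Real.sqrt η = ρ := Real.sqrt_sq hρ0.le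
  -- self-improvement on an initial segment where `‖u‖ ≤ 2b`
  have improve : ∀ t₁, t₁ < 0 → (∀ τ ∈ Icc t₀ t₁, ∀ x, ‖u τ x‖ ≤ 2 * b) →
      ∀ τ ∈ Icc t₀ t₁, ∀ x, ‖u τ x‖ ≤ 3 * b / 2 := by
    intro t₁ ht₁ hseg τ hτ x
    rcases eq_or_lt_of_le hτ.1 with heq | hlt
    · rw [← heq]
      linarith [ha x]
    · have hτ0 : τ < 0 := lt_of_le_of_lt hτ.2 ht₁
      rw [hmild t₀ τ hlt hτ0 x]
      have h_heat : ‖Literature.Analysis.UnboundedOperators.heatExtension (u t₀) (τ - t₀) x‖ ≤ a :=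
        Literature.Analysis.UnboundedOperators.norm_heatExtension_le_of_bound ha (sub_pos.2 hlt) x
      have h_duh : ‖oseenDuhamel 1 t₀ u u τ x‖ ≤ 2 * C * (2 * b) ^ 2 * Real.sqrt (τ - t₀) :=
        hB t₀ τ (2 * b) hlt (by positivity)
          (fun σ hσ y => hseg σ ⟨hσ.1.le, hσ.2.le.trans hτ.2⟩ y) x
      have h_sqrt : Real.sqrt (τ - t₀) ≤ Real.sqrt (-t₀) := Real.sqrt_le_sqrt (by linarith)
      calc ‖Literature.Analysis.UnboundedOperators.heatExtension (u t₀) (τ - t₀) x -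
              oseenDuhamel 1 t₀ u u τ x‖
          ≤ ‖Literature.Analysis.UnboundedOperators.heatExtension (u t₀) (τ - t₀) x‖ +
              ‖oseenDuhamel 1 t₀ u u τ x‖ := norm_sub_le _ _
        _ ≤ a + 2 * C * (2 * b) ^ 2 * Real.sqrt (-t₀) :=
            add_le_add h_heat (h_duh.trans (by gcongr))
        _ = a + b / 2 * (16 * C * b * Real.sqrt (-t₀)) := by ring
        _ ≤ a + b / 2 * 1 := by gcongr
        _ ≤ 3 * b / 2 := by linarith
  -- induction on blocks
  have blocks : ∀ n : ℕ, ∀ τ, t₀ ≤ τ → τ ≤ t₀ + n * η → τ ≤ t → ∀ x, ‖u τ x‖ ≤ 2 * b := by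
    intro n
    induction n with
    | zero =>
      intro τ h1 h2 _ x
      have hτ : τ = t₀ := le_antisymm (by simpa using h2) h1
      rw [hτ]
      linarith [ha x]
    | succ n ih =>
      intro τ h1 h2 h3 x
      rcases le_or_gt τ (t₀ + n * η) with h4 | h4
      · exact ih τ h1 h4 h3 x
      · -- `t₁ := t₀ + n η < τ ≤ t < 0`
        have hnη : 0 ≤ (n : ℝ) * η := by positivity
        have ht₁0 : t₀ + n * η < 0 := by linarith [ht.2]
        have hτ0 : τ < 0 := lt_of_le_of_lt h3 ht.2
        have hseg : ∀ σ ∈ Icc t₀ (t₀ + n * η), ∀ x, ‖u σ x‖ ≤ 2 * b := fun σ hσ x =>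
          ih σ hσ.1 hσ.2 (by linarith [hσ.2]) x
        have himp := improve (t₀ + n * η) ht₁0 hseg
        rw [hmild (t₀ + n * η) τ h4 hτ0 x]
        have h_heat :
            ‖Literature.Analysis.UnboundedOperators.heatExtension (u (t₀ + n * η))
                (τ - (t₀ + n * η)) x‖ ≤ 3 * b / 2 :=
          Literature.Analysis.UnboundedOperators.norm_heatExtension_le_of_bound
            (fun z => himp (t₀ + n * η) ⟨by linarith, le_rfl⟩ z) (sub_pos.2 h4) x
        have h_duh : ‖oseenDuhamel 1 (t₀ + n * η) u u τ x‖ ≤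
            2 * C * M' ^ 2 * Real.sqrt (τ - (t₀ + n * η)) :=
          hB (t₀ + n * η) τ M' h4 hM'0 (fun σ hσ y => hcrude' σ (hσ.2.le.trans h3) y) x
        have h_sqrt : Real.sqrt (τ - (t₀ + n * η)) ≤ ρ := by
          rw [← hsqη]
          exact Real.sqrt_le_sqrt (by push_cast at h2; linarith)
        calc ‖Literature.Analysis.UnboundedOperators.heatExtension (u (t₀ + n * η))
                  (τ - (t₀ + n * η)) x - oseenDuhamel 1 (t₀ + n * η) u u τ x‖
            ≤ ‖Literature.Analysis.UnboundedOperators.heatExtension (u (t₀ + n * η))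
                  (τ - (t₀ + n * η)) x‖ + ‖oseenDuhamel 1 (t₀ + n * η) u u τ x‖ :=
              norm_sub_le _ _
          _ ≤ 3 * b / 2 + 2 * C * M' ^ 2 * ρ := add_le_add h_heat (h_duh.trans (by gcongr))
          _ ≤ 2 * b := by linarith
  obtain ⟨n, hn⟩ := exists_nat_ge ((t - t₀) / η)
  exact blocks n t ht.1 (by rw [div_le_iff₀ hη0] at hn; linarith) le_rfl x

/-- **Trapping, sharp form.** Under the hypotheses of `switchOff_trap` with `16 C a √(−t₀) < 1` in
place of the room `a < b`, `16 C b √(−t₀) ≤ 1`: `‖u(t)‖_∞ ≤ 2a` on `[t₀, 0)` (apply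
`switchOff_trap` with `b = min (c/2) (1/(16 C √(−t₀)))` for every `c > 2a` and let `c ↓ 2a`). -/
theorem switchOff_physical {u : ℝ → EuclideanSpace ℝ (Fin 3) → EuclideanSpace ℝ (Fin 3)}
    {C K₀ t₀ a : ℝ} (hC : 0 < C)
    (hB : ∀ s t M : ℝ, s < t → 0 ≤ M → (∀ τ ∈ Ioo s t, ∀ y, ‖u τ y‖ ≤ M) →
      ∀ x, ‖oseenDuhamel 1 s u u t x‖ ≤ 2 * C * M ^ 2 * Real.sqrt (t - s))
    (hmild : ∀ s t : ℝ, s < t → t < 0 → ∀ x,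
      u t x = Literature.Analysis.UnboundedOperators.heatExtension (u s) (t - s) x -
        oseenDuhamel 1 s u u t x)
    (hK₀ : 0 ≤ K₀) (hcrude : ∀ t < 0, ∀ x, ‖u t x‖ ≤ K₀ / Real.sqrt (-t))
    (ht₀ : t₀ < 0) (ha : ∀ x, ‖u t₀ x‖ ≤ a) (hsmall : 16 * C * a * Real.sqrt (-t₀) < 1) :
    ∀ t ∈ Ico t₀ 0, ∀ x, ‖u t x‖ ≤ 2 * a := by
  intro t ht x
  have hsq : 0 < Real.sqrt (-t₀) := Real.sqrt_pos.2 (neg_pos.2 ht₀)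
  have hpos : 0 < 16 * C * Real.sqrt (-t₀) := by positivity
  refine le_of_forall_gt_imp_ge_of_dense fun c hc => ?_
  set b : ℝ := min (c / 2) (1 / (16 * C * Real.sqrt (-t₀))) with hb_def
  have hab : a < b := by
    refine lt_min (by linarith) ?_
    rw [lt_div_iff₀ hpos]
    linarith
  have hb : 16 * C * b * Real.sqrt (-t₀) ≤ 1 := by
    have h : b ≤ 1 / (16 * C * Real.sqrt (-t₀)) := min_le_right _ _
    rw [le_div_iff₀ hpos] at h
    linarith
  have key := switchOff_trap hC hB hmild hK₀ hcrude ha hab hb t ht x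
  linarith [min_le_left (c / 2) (1 / (16 * C * Real.sqrt (-t₀)))]

/-! ### The registered stubs -/

/-- **Stub `stub_singleTimeSwitchOff`** (KNSS's `L^∞` local theory made scale invariant). There is
an absolute constant `ε₀ > 0` (`ε₀ = 1/(32 C)`, `C` the constant of the bilinear bound
`exists_norm_oseenDuhamel_bounded_le`) such that: if an eternal profile-class solution `(U, P)` of
Leray's backward system has `‖U(s₀, y)‖ ≤ ε ≤ ε₀` for all `y` at ONE similarity time `s₀`, then
`‖U(s, y)‖ ≤ 2ε e^{−(s − s₀)/2}` for all `s ≥ s₀` and all `y`. The physical field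
`u = ofLerayOrbit U` is classical on `(−∞, 0)` with `‖u(t)‖_∞ ≤ K₀/√(−t)`, `r‖u‖ ≤ K₀`, hence
Oseen-mild between negative times (`KNSS2009_mild_of_rMulNorm_bounded_holds`); with `t₀ = −e^{−s₀}`,
`‖u(t₀)‖_∞ ≤ ε/√(−t₀)` and `switchOff_physical` traps `‖u(t)‖_∞ ≤ 2ε/√(−t₀)` up to `t = 0`; in
similarity variables `‖U(s, y)‖ = e^{−s/2}‖u(−e^{−s}, e^{−s/2}y)‖ ≤ 2ε e^{−(s−s₀)/2}`. -/
theorem stub_singleTimeSwitchOff :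
    ∃ ε₀ : ℝ, 0 < ε₀ ∧
      ∀ (U : ℝ → EuclideanSpace ℝ (Fin 3) → EuclideanSpace ℝ (Fin 3)) (P : ℝ → EuclideanSpace ℝ (Fin 3) → ℝ),
        IsBackwardLeraySolutionOn univ 1 U P →
        (∀ k : ℕ, ∃ K : ℝ, ∀ s y, (1 + ‖y‖) ^ (k + 1) * ‖iteratedFDeriv ℝ k (U s) y‖ ≤ K) →
        ∀ (s₀ ε : ℝ), ε ≤ ε₀ → (∀ y, ‖U s₀ y‖ ≤ ε) →
          ∀ s, s₀ ≤ s → ∀ y, ‖U s y‖ ≤ 2 * ε * Real.exp (-(s - s₀) / 2) := by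
  obtain ⟨C, hC, hB⟩ := exists_norm_oseenDuhamel_bounded_le (E := EuclideanSpace ℝ (Fin 3))
  refine ⟨1 / (32 * C), by positivity, ?_⟩
  intro U P hL hprof s₀ ε hε hUε s hs y
  -- the order-zero profile constant and the Type-I bound of the physical field
  obtain ⟨K₀, hK₀'⟩ := hprof 0
  have hK₀ : ∀ s y, (1 + ‖y‖) * ‖U s y‖ ≤ K₀ := fun s y => by
    have h := hK₀' s y
    rwa [zero_add, pow_one, norm_iteratedFDeriv_zero] at h
  have hK₀nn : 0 ≤ K₀ := le_trans (by positivity) (hK₀ 0 0)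
  set u := ofLerayOrbit U with hu_def
  have hcl : IsClassicalNSSolutionOn (Iio 0) 1 0 u (ofLerayOrbitPressure P) :=
    isClassicalNSSolutionOn_Iio_ofLerayOrbit_iff.2 hL
  have hdec : HasTypeIDecay K₀ u := by
    refine hasTypeIDecay_iff_lerayOrbit.2 fun s y => ?_
    rw [hu_def, lerayOrbit_ofLerayOrbit_eq]
    exact hK₀ s y
  have hcrude : ∀ t < 0, ∀ x, ‖u t x‖ ≤ K₀ / Real.sqrt (-t) := hdec.hasTypeITimeDecay hK₀nn
  -- the Oseen identity between all pairs of negative times (KNSS Thm 6.1, mildness clause)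
  have hmild : ∀ s t : ℝ, s < t → t < 0 → ∀ x,
      u t x = Literature.Analysis.UnboundedOperators.heatExtension (u s) (t - s) x -
        oseenDuhamel 1 s u u t x := by
    intro s t hst ht x
    have hwin : IsClassicalNSSolutionOn (Ioo (s - 1) 0) 1 0 u (ofLerayOrbitPressure P) :=
      hcl.mono (fun τ hτ => hτ.2) (uniqueDiffOn_Ioo _ _)
    have hsqt : 0 < Real.sqrt (-t) := Real.sqrt_pos.2 (neg_pos.2 ht)
    have hL' : ∃ L : ℝ, ∀ τ ∈ Ioc (s - 1) t, ∀ x, ‖u τ x‖ ≤ L :=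
      ⟨K₀ / Real.sqrt (-t), fun τ hτ x => (hcrude τ (hτ.2.trans_lt ht) x).trans
        (div_le_div_of_nonneg_left hK₀nn hsqt (Real.sqrt_le_sqrt (by linarith [hτ.2])))⟩
    have hD : ∃ D : ℝ, ∀ τ ∈ Ioc (s - 1) t, ∀ x, cylRadius x * ‖u τ x‖ ≤ D :=
      ⟨K₀, fun τ hτ x => reduction_cylRadius_mul_norm_le hdec τ (hτ.2.trans_lt ht) x⟩
    exact KNSS2009_mild_of_rMulNorm_bounded_holds hwin (by linarith) ht hL' hD (by linarith) hst
      le_rfl x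
  -- the bilinear bound at `ν = 1`
  have hB1 : ∀ s t M : ℝ, s < t → 0 ≤ M → (∀ τ ∈ Ioo s t, ∀ y, ‖u τ y‖ ≤ M) →
      ∀ x, ‖oseenDuhamel 1 s u u t x‖ ≤ 2 * C * M ^ 2 * Real.sqrt (t - s) := by
    intro s t M hst hM h x
    calc ‖oseenDuhamel 1 s u u t x‖
        ≤ C * M ^ 2 * (1 : ℝ) ^ (-(1 / 2 : ℝ)) * (2 * Real.sqrt (t - s)) := hB one_pos hst hM h h x
      _ = 2 * C * M ^ 2 * Real.sqrt (t - s) := by rw [Real.one_rpow]; ring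
  -- the initial physical time `t₀ = -e^{-s₀}` and amplitude `a = ε / √(-t₀)`
  set t₀ : ℝ := -Real.exp (-s₀) with ht₀_def
  have ht₀ : t₀ < 0 := neg_exp_neg_lt_zero s₀
  have hnegt₀ : -t₀ = Real.exp (-s₀) := neg_neg _
  have hsq₀ : Real.sqrt (-t₀) = Real.exp (-s₀ / 2) := by rw [hnegt₀, sqrt_exp_neg]
  have hlog : -Real.log (-t₀) = s₀ := by rw [hnegt₀]; exact neg_log_exp_neg s₀
  have hsqpos : 0 < Real.sqrt (-t₀) := Real.sqrt_pos.2 (neg_pos.2 ht₀)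
  set a : ℝ := (Real.sqrt (-t₀))⁻¹ * ε with ha_def
  have ha : ∀ x, ‖u t₀ x‖ ≤ a := fun x => by
    rw [hu_def, ofLerayOrbit_apply, hlog, norm_smul, norm_inv, Real.norm_of_nonneg hsqpos.le]
    exact mul_le_mul_of_nonneg_left (hUε _) (inv_nonneg.2 hsqpos.le)
  have hsmall : 16 * C * a * Real.sqrt (-t₀) < 1 := by
    have h1 : 16 * C * a * Real.sqrt (-t₀) = 16 * C * ε := by
      rw [ha_def]
      field_simp
    have h2 : ε ≤ 1 / (32 * C) := hε
    rw [le_div_iff₀ (by positivity)] at h2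
    rw [h1]
    linarith
  have hphys := switchOff_physical hC hB1 hmild hK₀nn hcrude ht₀ ha hsmall
  -- back to similarity variables at `t = -e^{-s} ∈ [t₀, 0)`
  have ht : -Real.exp (-s) ∈ Ico t₀ 0 :=
    ⟨neg_le_neg (Real.exp_le_exp.2 (by linarith)), neg_exp_neg_lt_zero s⟩
  have e : U s y = lerayOrbit u s y := by rw [hu_def, lerayOrbit_ofLerayOrbit_eq]
  rw [e, lerayOrbit_apply, norm_smul, Real.norm_of_nonneg (Real.exp_pos _).le]
  have key := hphys (-Real.exp (-s)) ht (Real.exp (-s / 2) • y)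
  calc Real.exp (-s / 2) * ‖u (-Real.exp (-s)) (Real.exp (-s / 2) • y)‖
      ≤ Real.exp (-s / 2) * (2 * a) := mul_le_mul_of_nonneg_left key (Real.exp_pos _).le
    _ = 2 * ε * Real.exp (-(s - s₀) / 2) := by
        rw [ha_def, hsq₀, show -(s - s₀) / 2 = -s / 2 - -s₀ / 2 by ring, Real.exp_sub]
        field_simp

/-- **Stub `stub_pastSmallnessLiouville`.** An eternal profile-class solution of Leray's backward
system whose amplitude becomes `δ`-small at arbitrarily early similarity times, for every `δ > 0`
(`liminf_{s → −∞} ‖U(s)‖_∞ = 0`), vanishes identically: given `s, y` and `0 < δ ≤ ε₀`, a time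
`s′ ≤ s` with `‖U(s′)‖_∞ ≤ δ` gives `‖U(s, y)‖ ≤ 2δ e^{−(s−s′)/2} ≤ 2δ` (`stub_singleTimeSwitchOff`);
let `δ ↓ 0`. Complement of the landed `remotePastLiouville`. -/
theorem stub_pastSmallnessLiouville :
    ∀ (U : ℝ → EuclideanSpace ℝ (Fin 3) → EuclideanSpace ℝ (Fin 3)) (P : ℝ → EuclideanSpace ℝ (Fin 3) → ℝ),
      IsBackwardLeraySolutionOn univ 1 U P →
      (∀ k : ℕ, ∃ K : ℝ, ∀ s y, (1 + ‖y‖) ^ (k + 1) * ‖iteratedFDeriv ℝ k (U s) y‖ ≤ K) →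
      (∀ δ : ℝ, 0 < δ → ∀ S : ℝ, ∃ s ≤ S, ∀ y, ‖U s y‖ ≤ δ) → ∀ s y, U s y = 0 := by
  obtain ⟨ε₀, hε₀, hD⟩ := stub_singleTimeSwitchOff
  intro U P hL hprof hsmall s y
  rw [← norm_le_zero_iff]
  refine le_of_forall_gt_imp_ge_of_dense fun c hc => ?_
  set δ : ℝ := min (c / 2) ε₀ with hδ_def
  have hδ : 0 < δ := lt_min (by linarith) hε₀
  obtain ⟨s', hs', hUδ⟩ := hsmall δ hδ s
  have key := hD U P hL hprof s' δ (min_le_right _ _) hUδ s hs' y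
  have hexp : Real.exp (-(s - s') / 2) ≤ 1 := Real.exp_le_one_iff.2 (by linarith)
  calc ‖U s y‖ ≤ 2 * δ * Real.exp (-(s - s') / 2) := key
    _ ≤ 2 * δ * 1 := by gcongr
    _ ≤ c := by linarith [min_le_left (c / 2) ε₀]

end Summit.NavierStokesRegularity.NavierStokesRegularity.Theorems.NoSelfExcitedDynamo.Registered

end
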